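import Summits.CriticalPhenomena.PercolationContinuityZ3.Theorems.PercNearOneGluingNoHeavyLowerTailForestRayleighStepsFree
import Summits.CriticalPhenomena.PercolationContinuityZ3.Theorems.PercNearOneGluingNoHeavyLowerTailForestRayleighSteps
import HarnessLib

/-!
# Weighted forest negative correlation on graphs of tree-width ≤ 2 — VI: dispatch at a vertex of degree ≤ 2 (pendant; series vertex carrying `e`)

Notation as in `…ForestRayleighTools`: `Z(D;K)` the pinned weighted forest partition function and
`(R)(D;K;e,f) : Z(D;K∪{e,f})·Z(D;K) ≤ Z(D;K∪{e})·Z(D;K∪{f})`.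

The induction of `…ForestRayleighTreewidthTwo` runs on the number of edges of the instance
`E = D ∪ K ∪ {e,f} ⊆ T` and eliminates a vertex `v` meeting at most two edges of `E` whose chord
(if any) lies in `T`. This file packages the induction hypothesis as an explicit assumption `ih`
(the Rayleigh inequality for every admissible instance inside `T` with fewer edges, for every
nonnegative activity) and proves the step when
* `v` is pendant in `E` (`step_pendant`: its edge is `e`, `f`, free or pinned), and when
* `v` has degree two and carries `e` (`step_series_e`: the other edge is `f`, free or pinned),
reducing to the step lemmas of `…ForestRayleighSteps` / `…StepsFree`. Also: symmetry of `(R)` in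
`e, f` and the two edge-count lemmas used to call `ih`. Theorems only; no definitions, no `sorry`.
-/

open Finset SimpleGraph
open scoped Classical

namespace Summit.CriticalPhenomena.PercolationContinuityZ3.Theorems.ForestRayleigh

variable {V : Type*} [Fintype V] [DecidableEq V]

/-! ### §1 Generic tools -/

omit [Fintype V] in
/-- `(R)` is symmetric in `e, f`. [elementary] -/
theorem lsm_symm (w : Sym2 V → ℝ) (D K : Finset (Sym2 V)) (e f : Sym2 V)
    (h : (∑ G ∈ D.powerset.filter (fun G =>
        (fromEdgeSet ((G ∪ (insert f (insert e K)) : Finset (Sym2 V)) : Set (Sym2 V))).IsAcyclic), ∏ x ∈ G, w x) *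
      (∑ G ∈ D.powerset.filter (fun G =>
        (fromEdgeSet ((G ∪ K : Finset (Sym2 V)) : Set (Sym2 V))).IsAcyclic), ∏ x ∈ G, w x) ≤
    (∑ G ∈ D.powerset.filter (fun G =>
        (fromEdgeSet ((G ∪ (insert f K) : Finset (Sym2 V)) : Set (Sym2 V))).IsAcyclic), ∏ x ∈ G, w x) *
      (∑ G ∈ D.powerset.filter (fun G =>
        (fromEdgeSet ((G ∪ (insert e K) : Finset (Sym2 V)) : Set (Sym2 V))).IsAcyclic), ∏ x ∈ G, w x)) :
    (∑ G ∈ D.powerset.filter (fun G =>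
        (fromEdgeSet ((G ∪ (insert e (insert f K)) : Finset (Sym2 V)) : Set (Sym2 V))).IsAcyclic), ∏ x ∈ G, w x) *
      (∑ G ∈ D.powerset.filter (fun G =>
        (fromEdgeSet ((G ∪ K : Finset (Sym2 V)) : Set (Sym2 V))).IsAcyclic), ∏ x ∈ G, w x) ≤
    (∑ G ∈ D.powerset.filter (fun G =>
        (fromEdgeSet ((G ∪ (insert e K) : Finset (Sym2 V)) : Set (Sym2 V))).IsAcyclic), ∏ x ∈ G, w x) *
      (∑ G ∈ D.powerset.filter (fun G =>
        (fromEdgeSet ((G ∪ (insert f K) : Finset (Sym2 V)) : Set (Sym2 V))).IsAcyclic), ∏ x ∈ G, w x) := by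
  rw [Finset.insert_comm e f K]
  calc _ ≤ _ := h
    _ = _ := mul_comm _ _

omit [Fintype V] in
/-- Edge count after deleting a pendant vertex. [elementary] -/
theorem card_lt_of_subset_erase {E E' : Finset (Sym2 V)} {g : Sym2 V} (hg : g ∈ E)
    (h : ∀ x ∈ E', x ∈ E ∧ x ≠ g) : E'.card < E.card := by
  have hs : E' ⊆ E.erase g := fun x hx => Finset.mem_erase.2 ⟨(h x hx).2, (h x hx).1⟩
  exact (Finset.card_le_card hs).trans_lt (Finset.card_erase_lt_of_mem hg)

omit [Fintype V] in
/-- Edge count after a series reduction (two edges out, at most one chord in). [elementary] -/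
theorem card_lt_of_subset_series {E E' : Finset (Sym2 V)} {g₁ g₂ h : Sym2 V} (h₁ : g₁ ∈ E)
    (h₂ : g₂ ∈ E) (h12 : g₁ ≠ g₂) (hs : ∀ x ∈ E', x = h ∨ (x ∈ E ∧ x ≠ g₁ ∧ x ≠ g₂)) :
    E'.card < E.card := by
  have hsub : E' ⊆ insert h ((E.erase g₁).erase g₂) := by
    intro x hx
    rcases hs x hx with hx | ⟨hxE, hx₁, hx₂⟩
    · exact hx ▸ Finset.mem_insert_self _ _
    · exact Finset.mem_insert_of_mem (Finset.mem_erase.2 ⟨hx₂, Finset.mem_erase.2 ⟨hx₁, hxE⟩⟩)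
  have hg₂ : g₂ ∈ E.erase g₁ := Finset.mem_erase.2 ⟨h12.symm, h₂⟩
  have c₁ := Finset.card_le_card hsub
  have c₂ := Finset.card_insert_le h ((E.erase g₁).erase g₂)
  have c₃ : ((E.erase g₁).erase g₂).card = E.card - 1 - 1 := by
    rw [Finset.card_erase_of_mem hg₂, Finset.card_erase_of_mem h₁]
  have c₄ : 1 < E.card := Finset.one_lt_card.2 ⟨g₁, h₁, g₂, h₂, h12⟩
  omega

/-! ### §2 Pendant vertex -/

/-- **Induction step at a pendant vertex.** If `v` meets exactly one edge `vu` of the instance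
`E = D ∪ K ∪ {e,f} ⊆ T` (`T` loop-free) and `(R)` holds for all admissible instances inside `T`
with fewer edges, then `(R)(D;K;e,f)`. [S–W Prop. 3.7 via `lsm_pendant_*`] -/
theorem step_pendant (T : Finset (Sym2 V)) (hT : ∀ x ∈ T, ¬x.IsDiag) (w : Sym2 V → ℝ)
    (hw : ∀ x, 0 ≤ w x) (D K : Finset (Sym2 V)) (e f : Sym2 V) {v u : V}
    (hsub : D ∪ insert e (insert f K) ⊆ T) (hDK : Disjoint D K) (heD : e ∉ D) (heK : e ∉ K)
    (hfD : f ∉ D) (hfK : f ∉ K) (hef : e ≠ f) (hg : s(v, u) ∈ D ∪ insert e (insert f K))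
    (honly : ∀ z ∈ D ∪ insert e (insert f K), v ∈ z → z = s(v, u))
    (ih : ∀ (w' : Sym2 V → ℝ), (∀ x, 0 ≤ w' x) → ∀ (D' K' : Finset (Sym2 V)) (e' f' : Sym2 V),
      (D' ∪ insert e' (insert f' K')).card < (D ∪ insert e (insert f K)).card →
      D' ∪ insert e' (insert f' K') ⊆ T → Disjoint D' K' → e' ∉ D' → e' ∉ K' → f' ∉ D' →
      f' ∉ K' → e' ≠ f' →
      (∑ G ∈ D'.powerset.filter (fun G =>
        (fromEdgeSet ((G ∪ (insert e' (insert f' K')) : Finset (Sym2 V)) : Set (Sym2 V))).IsAcyclic), ∏ x ∈ G, w' x) *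
      (∑ G ∈ D'.powerset.filter (fun G =>
        (fromEdgeSet ((G ∪ K' : Finset (Sym2 V)) : Set (Sym2 V))).IsAcyclic), ∏ x ∈ G, w' x) ≤
    (∑ G ∈ D'.powerset.filter (fun G =>
        (fromEdgeSet ((G ∪ (insert e' K') : Finset (Sym2 V)) : Set (Sym2 V))).IsAcyclic), ∏ x ∈ G, w' x) *
      (∑ G ∈ D'.powerset.filter (fun G =>
        (fromEdgeSet ((G ∪ (insert f' K') : Finset (Sym2 V)) : Set (Sym2 V))).IsAcyclic), ∏ x ∈ G, w' x)) :
    (∑ G ∈ D.powerset.filter (fun G =>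
        (fromEdgeSet ((G ∪ (insert e (insert f K)) : Finset (Sym2 V)) : Set (Sym2 V))).IsAcyclic), ∏ x ∈ G, w x) *
      (∑ G ∈ D.powerset.filter (fun G =>
        (fromEdgeSet ((G ∪ K : Finset (Sym2 V)) : Set (Sym2 V))).IsAcyclic), ∏ x ∈ G, w x) ≤
    (∑ G ∈ D.powerset.filter (fun G =>
        (fromEdgeSet ((G ∪ (insert e K) : Finset (Sym2 V)) : Set (Sym2 V))).IsAcyclic), ∏ x ∈ G, w x) *
      (∑ G ∈ D.powerset.filter (fun G =>
        (fromEdgeSet ((G ∪ (insert f K) : Finset (Sym2 V)) : Set (Sym2 V))).IsAcyclic), ∏ x ∈ G, w x) := by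
  have hE : ∀ x ∈ D ∪ insert e (insert f K), ¬x.IsDiag := fun x hx => hT x (hsub hx)
  have huv : u ≠ v := fun hh => hE _ hg (Sym2.mk_isDiag_iff.2 hh.symm)
  have hv : ∀ z ∈ D ∪ insert e (insert f K), z ≠ s(v, u) → v ∉ z :=
    fun z hz hne hvz => hne (honly z hz hvz)
  have hg' : s(v, u) ∈ D ∨ s(v, u) = e ∨ s(v, u) = f ∨ s(v, u) ∈ K := by
    simpa only [Finset.mem_union, Finset.mem_insert] using hg
  rcases hg' with hgD | hge | hgf | hgK
  · -- the pendant edge is free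
    have hgK : s(v, u) ∉ K := Finset.disjoint_left.1 hDK hgD
    have hge : s(v, u) ≠ e := fun hh => heD (hh ▸ hgD)
    have hgf : s(v, u) ≠ f := fun hh => hfD (hh ▸ hgD)
    have hD' : D = insert s(v, u) (D.erase s(v, u)) := (Finset.insert_erase hgD).symm
    have sub₁ : D.erase s(v, u) ∪ insert e (insert f K) ⊆ D ∪ insert e (insert f K) :=
      Finset.union_subset_union (Finset.erase_subset _ _) subset_rfl
    rw [hD']
    refine lsm_pendant_free w (D.erase s(v, u)) K e f (fun x hx => hE x (sub₁ hx)) ?_ huv ?_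
    · intro x hx
      refine hv x (sub₁ hx) ?_
      rcases Finset.mem_union.1 hx with hx | hx
      · exact (Finset.mem_erase.1 hx).1
      · rcases Finset.mem_insert.1 hx with rfl | hx
        · exact hge.symm
        rcases Finset.mem_insert.1 hx with rfl | hx
        · exact hgf.symm
        · exact fun hh => hgK (hh ▸ hx)
    · refine ih w hw (D.erase s(v, u)) K e f ?_ (sub₁.trans hsub)
        (Finset.disjoint_of_subset_left (Finset.erase_subset _ _) hDK)
        (fun hh => heD (Finset.mem_of_mem_erase hh)) heK
        (fun hh => hfD (Finset.mem_of_mem_erase hh)) hfK hef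
      · refine card_lt_of_subset_erase hg fun x hx => ⟨sub₁ hx, ?_⟩
        rcases Finset.mem_union.1 hx with hx | hx
        · exact (Finset.mem_erase.1 hx).1
        · rcases Finset.mem_insert.1 hx with rfl | hx
          · exact hge.symm
          rcases Finset.mem_insert.1 hx with rfl | hx
          · exact hgf.symm
          · exact fun hh => hgK (hh ▸ hx)
  · -- the pendant edge is `e`
    subst hge
    refine lsm_pendant_self w D K f (fun x hx => hE x ?_) (fun x hx => hv x ?_ ?_) huv
    · simp only [Finset.mem_union, Finset.mem_insert] at hx ⊢; tauto
    · simp only [Finset.mem_union, Finset.mem_insert] at hx ⊢; tauto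
    · rcases Finset.mem_union.1 hx with hx | hx
      · exact fun hh => heD (hh ▸ hx)
      · rcases Finset.mem_insert.1 hx with rfl | hx
        · exact hef.symm
        · exact fun hh => heK (hh ▸ hx)
  · -- the pendant edge is `f`
    subst hgf
    refine lsm_symm w D K e _ (lsm_pendant_self w D K e (fun x hx => hE x ?_) (fun x hx => hv x ?_ ?_) huv)
    · simp only [Finset.mem_union, Finset.mem_insert] at hx ⊢; tauto
    · simp only [Finset.mem_union, Finset.mem_insert] at hx ⊢; tauto
    · rcases Finset.mem_union.1 hx with hx | hx
      · exact fun hh => hfD (hh ▸ hx)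
      · rcases Finset.mem_insert.1 hx with rfl | hx
        · exact hef
        · exact fun hh => hfK (hh ▸ hx)
  · -- the pendant edge is pinned
    have hgD : s(v, u) ∉ D := Finset.disjoint_right.1 hDK hgK
    have hge : s(v, u) ≠ e := fun hh => heK (hh ▸ hgK)
    have hgf : s(v, u) ≠ f := fun hh => hfK (hh ▸ hgK)
    have hK' : K = insert s(v, u) (K.erase s(v, u)) := (Finset.insert_erase hgK).symm
    have sub₁ : D ∪ insert e (insert f (K.erase s(v, u))) ⊆ D ∪ insert e (insert f K) :=
      Finset.union_subset_union subset_rfl (Finset.insert_subset_insert e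
        (Finset.insert_subset_insert f (Finset.erase_subset _ _)))
    rw [hK']
    refine lsm_pendant_pin w D (K.erase s(v, u)) e f (fun x hx => hE x (sub₁ hx)) ?_ huv ?_
    · intro x hx
      refine hv x (sub₁ hx) ?_
      rcases Finset.mem_union.1 hx with hx | hx
      · exact fun hh => hgD (hh ▸ hx)
      · rcases Finset.mem_insert.1 hx with rfl | hx
        · exact hge.symm
        rcases Finset.mem_insert.1 hx with rfl | hx
        · exact hgf.symm
        · exact (Finset.mem_erase.1 hx).1
    · refine ih w hw D (K.erase s(v, u)) e f ?_ (sub₁.trans hsub)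
        (Finset.disjoint_of_subset_right (Finset.erase_subset _ _) hDK) heD
        (fun hh => heK (Finset.mem_of_mem_erase hh)) hfD
        (fun hh => hfK (Finset.mem_of_mem_erase hh)) hef
      · refine card_lt_of_subset_erase hg fun x hx => ⟨sub₁ hx, ?_⟩
        rcases Finset.mem_union.1 hx with hx | hx
        · exact fun hh => hgD (hh ▸ hx)
        · rcases Finset.mem_insert.1 hx with rfl | hx
          · exact hge.symm
          rcases Finset.mem_insert.1 hx with rfl | hx
          · exact hgf.symm
          · exact (Finset.mem_erase.1 hx).1


/-! ### §3 Series vertex carrying `e` -/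

/-- **Induction step at a degree-two vertex carrying `e`.** If `v` meets exactly the edges
`e = vu₁` and `vu₂` of the instance `E = D ∪ K ∪ {e,f} ⊆ T` (`T` loop-free, chord `u₁u₂ ∈ T`) and
`(R)` holds for all admissible instances inside `T` with fewer edges, then `(R)(D;K;e,f)`.
[S–W Prop. 3.7 via `lsm_series_self/free/pin`] -/
theorem step_series_e (T : Finset (Sym2 V)) (hT : ∀ x ∈ T, ¬x.IsDiag) (w : Sym2 V → ℝ)
    (hw : ∀ x, 0 ≤ w x) (D K : Finset (Sym2 V)) (f : Sym2 V) {v u₁ u₂ : V}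
    (hsub : D ∪ insert s(v, u₁) (insert f K) ⊆ T) (hDK : Disjoint D K) (heD : s(v, u₁) ∉ D)
    (heK : s(v, u₁) ∉ K) (hfD : f ∉ D) (hfK : f ∉ K) (hef : s(v, u₁) ≠ f) (hu : u₁ ≠ u₂)
    (hg : s(v, u₂) ∈ D ∪ insert f K)
    (honly : ∀ z ∈ D ∪ insert s(v, u₁) (insert f K), v ∈ z → z = s(v, u₁) ∨ z = s(v, u₂))
    (hhT : s(u₁, u₂) ∈ T)
    (ih : ∀ (w' : Sym2 V → ℝ), (∀ x, 0 ≤ w' x) → ∀ (D' K' : Finset (Sym2 V)) (e' f' : Sym2 V),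
      (D' ∪ insert e' (insert f' K')).card < (D ∪ insert s(v, u₁) (insert f K)).card →
      D' ∪ insert e' (insert f' K') ⊆ T → Disjoint D' K' → e' ∉ D' → e' ∉ K' → f' ∉ D' →
      f' ∉ K' → e' ≠ f' →
      (∑ G ∈ D'.powerset.filter (fun G =>
        (fromEdgeSet ((G ∪ (insert e' (insert f' K')) : Finset (Sym2 V)) : Set (Sym2 V))).IsAcyclic), ∏ x ∈ G, w' x) *
      (∑ G ∈ D'.powerset.filter (fun G =>
        (fromEdgeSet ((G ∪ K' : Finset (Sym2 V)) : Set (Sym2 V))).IsAcyclic), ∏ x ∈ G, w' x) ≤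
    (∑ G ∈ D'.powerset.filter (fun G =>
        (fromEdgeSet ((G ∪ (insert e' K') : Finset (Sym2 V)) : Set (Sym2 V))).IsAcyclic), ∏ x ∈ G, w' x) *
      (∑ G ∈ D'.powerset.filter (fun G =>
        (fromEdgeSet ((G ∪ (insert f' K') : Finset (Sym2 V)) : Set (Sym2 V))).IsAcyclic), ∏ x ∈ G, w' x)) :
    (∑ G ∈ D.powerset.filter (fun G =>
        (fromEdgeSet ((G ∪ (insert s(v, u₁) (insert f K)) : Finset (Sym2 V)) : Set (Sym2 V))).IsAcyclic), ∏ x ∈ G, w x) *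
      (∑ G ∈ D.powerset.filter (fun G =>
        (fromEdgeSet ((G ∪ K : Finset (Sym2 V)) : Set (Sym2 V))).IsAcyclic), ∏ x ∈ G, w x) ≤
    (∑ G ∈ D.powerset.filter (fun G =>
        (fromEdgeSet ((G ∪ (insert s(v, u₁) K) : Finset (Sym2 V)) : Set (Sym2 V))).IsAcyclic), ∏ x ∈ G, w x) *
      (∑ G ∈ D.powerset.filter (fun G =>
        (fromEdgeSet ((G ∪ (insert f K) : Finset (Sym2 V)) : Set (Sym2 V))).IsAcyclic), ∏ x ∈ G, w x) := by
  have hE : ∀ x ∈ D ∪ insert s(v, u₁) (insert f K), ¬x.IsDiag := fun x hx => hT x (hsub hx)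
  have hgE : s(v, u₂) ∈ D ∪ insert s(v, u₁) (insert f K) := by
    rcases Finset.mem_union.1 hg with hg | hg
    · exact Finset.mem_union_left _ hg
    · exact Finset.mem_union_right _ (Finset.mem_insert_of_mem hg)
  have heE : s(v, u₁) ∈ D ∪ insert s(v, u₁) (insert f K) :=
    Finset.mem_union_right _ (Finset.mem_insert_self _ _)
  have hvu₁ : v ≠ u₁ := fun hh => hE _ heE (Sym2.mk_isDiag_iff.2 hh)
  have hvu₂ : v ≠ u₂ := fun hh => hE _ hgE (Sym2.mk_isDiag_iff.2 hh)
  have hge : s(v, u₂) ≠ s(v, u₁) := fun hh => hu (Sym2.congr_right.1 hh).symm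
  have hv : ∀ z ∈ D ∪ insert s(v, u₁) (insert f K), z ≠ s(v, u₁) → z ≠ s(v, u₂) → v ∉ z :=
    fun z hz h₁ h₂ hvz => (honly z hz hvz).elim h₁ h₂
  have hg' : s(v, u₂) ∈ D ∨ s(v, u₂) = f ∨ s(v, u₂) ∈ K := by
    simpa only [Finset.mem_union, Finset.mem_insert] using hg
  rcases hg' with hgD | hgf | hgK
  · -- second edge free
    have hgK : s(v, u₂) ∉ K := Finset.disjoint_left.1 hDK hgD
    have hgf : s(v, u₂) ≠ f := fun hh => hfD (hh ▸ hgD)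
    have hD' : D = insert s(v, u₂) (D.erase s(v, u₂)) := (Finset.insert_erase hgD).symm
    have sub₀ : D.erase s(v, u₂) ⊆ D := Finset.erase_subset _ _
    rw [hD']
    refine lsm_series_free w hw (D.erase s(v, u₂)) K f (fun x hx => hE x ?_) (fun x hx => hv x ?_ ?_ ?_)
      hu (fun hh => hfD (sub₀ hh)) hfK ?_
    · simp only [Finset.mem_union, Finset.mem_insert] at hx ⊢
      rcases hx with hx | hx | hx | hx | hx
      · exact Or.inl (sub₀ hx)
      · exact Or.inr (Or.inl hx)
      · exact Or.inr (Or.inr (Or.inl hx))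
      · exact Or.inl (hx ▸ hgD)
      · exact Or.inr (Or.inr (Or.inr hx))
    · exact Finset.union_subset_union sub₀ (Finset.subset_insert _ _) hx
    · rcases Finset.mem_union.1 hx with hx | hx
      · exact fun hh => heD (hh ▸ sub₀ hx)
      · rcases Finset.mem_insert.1 hx with rfl | hx
        · exact hef.symm
        · exact fun hh => heK (hh ▸ hx)
    · rcases Finset.mem_union.1 hx with hx | hx
      · exact (Finset.mem_erase.1 hx).1
      · rcases Finset.mem_insert.1 hx with rfl | hx
        · exact hgf.symm
        · exact fun hh => hgK (hh ▸ hx)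
    · intro hhK hhf
      refine ih w hw ((D.erase s(v, u₂)).erase s(u₁, u₂)) K s(u₁, u₂) f ?_ ?_
        (Finset.disjoint_of_subset_left ((Finset.erase_subset _ _).trans sub₀) hDK)
        (Finset.notMem_erase _ _) hhK
        (fun hh => hfD (sub₀ (Finset.mem_of_mem_erase hh))) hfK hhf
      · refine card_lt_of_subset_series (h := s(u₁, u₂)) heE hgE hge.symm fun x hx => ?_
        rcases Finset.mem_union.1 hx with hx | hx
        · have hx₁ := Finset.mem_of_mem_erase hx
          exact Or.inr ⟨Finset.mem_union_left _ (sub₀ hx₁), fun hh => heD (hh ▸ sub₀ hx₁),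
            (Finset.mem_erase.1 hx₁).1⟩
        · rcases Finset.mem_insert.1 hx with hx | hx
          · exact Or.inl hx
          rcases Finset.mem_insert.1 hx with rfl | hx
          · exact Or.inr ⟨by simp, hef.symm, hgf.symm⟩
          · exact Or.inr ⟨by simp [hx], fun hh => heK (hh ▸ hx), fun hh => hgK (hh ▸ hx)⟩
      · intro x hx
        rcases Finset.mem_union.1 hx with hx | hx
        · exact hsub (Finset.mem_union_left _ (sub₀ (Finset.mem_of_mem_erase hx)))
        · rcases Finset.mem_insert.1 hx with rfl | hx
          · exact hhT
          · exact hsub (Finset.mem_union_right _ (Finset.mem_insert_of_mem hx))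
  · -- second edge is `f`
    subst hgf
    refine lsm_series_self w hw D K (fun x hx => hE x ?_) (fun x hx => hv x ?_ ?_ ?_) hvu₁.symm
      hvu₂.symm
    · exact Finset.union_subset_union subset_rfl
        ((Finset.subset_insert _ _).trans (Finset.subset_insert _ _)) hx
    · exact Finset.union_subset_union subset_rfl
        ((Finset.subset_insert _ _).trans (Finset.subset_insert _ _)) hx
    · rcases Finset.mem_union.1 hx with hx | hx
      · exact fun hh => heD (hh ▸ hx)
      · exact fun hh => heK (hh ▸ hx)
    · rcases Finset.mem_union.1 hx with hx | hx
      · exact fun hh => hfD (hh ▸ hx)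
      · exact fun hh => hfK (hh ▸ hx)
  · -- second edge pinned
    have hgD : s(v, u₂) ∉ D := Finset.disjoint_right.1 hDK hgK
    have hgf : s(v, u₂) ≠ f := fun hh => hfK (hh ▸ hgK)
    have hK' : K = insert s(v, u₂) (K.erase s(v, u₂)) := (Finset.insert_erase hgK).symm
    have sub₀ : K.erase s(v, u₂) ⊆ K := Finset.erase_subset _ _
    rw [hK']
    refine lsm_series_pin w hw D (K.erase s(v, u₂)) f (fun x hx => hE x ?_) (fun x hx => hv x ?_ ?_ ?_)
      hu hfD (fun hh => hfK (sub₀ hh)) ?_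
    · rw [← hK'] at hx; exact hx
    · exact Finset.union_subset_union subset_rfl
        ((Finset.insert_subset_insert f sub₀).trans (Finset.subset_insert _ _)) hx
    · rcases Finset.mem_union.1 hx with hx | hx
      · exact fun hh => heD (hh ▸ hx)
      · rcases Finset.mem_insert.1 hx with rfl | hx
        · exact hef.symm
        · exact fun hh => heK (hh ▸ sub₀ hx)
    · rcases Finset.mem_union.1 hx with hx | hx
      · exact fun hh => hgD (hh ▸ hx)
      · rcases Finset.mem_insert.1 hx with rfl | hx
        · exact hgf.symm
        · exact (Finset.mem_erase.1 hx).1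
    · intro hhK hhf
      refine ih w hw (D.erase s(u₁, u₂)) (K.erase s(v, u₂)) s(u₁, u₂) f ?_ ?_
        (Finset.disjoint_of_subset_left (Finset.erase_subset _ _)
          (Finset.disjoint_of_subset_right sub₀ hDK))
        (Finset.notMem_erase _ _) hhK (fun hh => hfD (Finset.mem_of_mem_erase hh))
        (fun hh => hfK (sub₀ hh)) hhf
      · refine card_lt_of_subset_series (h := s(u₁, u₂)) heE hgE hge.symm fun x hx => ?_
        rcases Finset.mem_union.1 hx with hx | hx
        · have hx₁ := Finset.mem_of_mem_erase hx
          exact Or.inr ⟨Finset.mem_union_left _ hx₁, fun hh => heD (hh ▸ hx₁), fun hh => hgD (hh ▸ hx₁)⟩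
        · rcases Finset.mem_insert.1 hx with hx | hx
          · exact Or.inl hx
          rcases Finset.mem_insert.1 hx with rfl | hx
          · exact Or.inr ⟨by simp, hef.symm, hgf.symm⟩
          · exact Or.inr ⟨by simp [sub₀ hx], fun hh => heK (hh ▸ sub₀ hx),
              (Finset.mem_erase.1 hx).1⟩
      · intro x hx
        rcases Finset.mem_union.1 hx with hx | hx
        · exact hsub (Finset.mem_union_left _ (Finset.mem_of_mem_erase hx))
        · rcases Finset.mem_insert.1 hx with rfl | hx
          · exact hhT
          · exact hsub (Finset.mem_union_right _ (Finset.mem_insert_of_mem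
              (Finset.insert_subset_insert f sub₀ hx)))


end Summit.CriticalPhenomena.PercolationContinuityZ3.Theorems.ForestRayleigh
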